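import Mathlib.ModelTheory.Algebra.Ring.Basic
import Mathlib.ModelTheory.Algebra.Field.Basic
import Mathlib.Algebra.BigOperators.Pi
import Mathlib.Data.Fintype.Pi
import HarnessLib

/-!
# `PairwiseCurvedTilingsLC` (crux stmt-MatrixMultiplication-17883), line LonelyTranslates:
the first-order encoding of "the big-`B` shadow lies on a box hypersurface"

Stub F of the lead's skeleton.  For ring formulas `φ_I(x; y)`, `φ_A, φ_B, φ_C(x, v; y)` presenting a
definable family `(A_x, B_x, C_x)_{x ∈ I}` in `K^m` with parameters `y ∈ K^k`, and for `C N : ℕ`,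
the property `LonelyShadowSem … C N K y` of the parameters `y` —
"IF the realised family satisfies pattern `i = j` of the pairwise STPP clause THEN some non-zero
box polynomial `Σ_β d_β ∏_l W_l^{β l}` (exponents `≤ N`) vanishes at every `a − c`, `a ∈ A_x`,
`c ∈ C_x`, over the blocks `x ∈ I` whose `B_x` has `C + 1` distinct points" —
is the realisation of ONE ring formula `θ_{C,N}(y)`, uniformly in the field `K` (with any compatible
ring structure): `stub_exists_lonelyShadowFormula`.

The proof is structural.  Call a property `P` of valuations `v : α → K` (in fields `K` with a
compatible ring structure) *definable* when ONE ring formula in the variables `α` realises it at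
every `v` in every such `K`.  Definable properties are closed under `→`, `∧`, finite conjunctions,
and quantification over finite blocks of new variables (`Formula.iAlls` / `Formula.iExs`) — the
lemmas `definable_imp`, `definable_and`, `definable_iInf`, `definable_forall`, `definable_exists`,
`definable_exists₂` — and the atoms of `LonelyShadowSem` are definable: instances of the given
formulas at re-indexed variables (`Formula.relabel`: `definable_realize₂`, `definable_realize₃`),
(in)equalities of tuples of variables (`definable_vecEq`, `definable_vecNeZero`,
`definable_patEq`), injectivity of a finite tuple of tuples (`definable_injective`), and the
box-polynomial equation (`definable_boxEq`, via the ring TERM `boxTerm` built from iterated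
sums/products/powers of terms).  The main theorem then follows the syntax tree of
`LonelyShadowSem`, each step being solved by higher-order pattern unification.  No finiteness or
pseudo-finiteness of `K` is used.
-/

set_option linter.dupNamespace false  -- `Summit.<S>.<S>.…` is the mandated namespace

namespace Summit.MatrixMultiplication.MatrixMultiplication.Theorems.PairwiseCurvedTilingsLC.Negative

open FirstOrder FirstOrder.Language FirstOrder.Ring

section Terms

variable {α : Type}

/-- The `n`-th power of a ring term, as an iterated product. -/
def termPow (t : Language.ring.Term α) : ℕ → Language.ring.Term α
  | 0 => 1
  | n + 1 => termPow t n * t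

/-- `termPow t n` realises `t ^ n`. -/
theorem realize_termPow {K : Type} [Field K] [CompatibleRing K] (t : Language.ring.Term α)
    (v : α → K) : ∀ n, (termPow t n).realize v = t.realize v ^ n
  | 0 => by rw [termPow, realize_one, pow_zero]
  | n + 1 => by rw [termPow, realize_mul, realize_termPow t v n, pow_succ]

/-- The sum of a finite family of ring terms (iterated over `Finset.univ.toList`). -/
noncomputable def termSum {ι : Type} [Fintype ι] (f : ι → Language.ring.Term α) :
    Language.ring.Term α :=
  ((Finset.univ : Finset ι).toList.map f).foldr (· + ·) 0

/-- `termSum f` realises `∑ i, f i`. -/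
theorem realize_termSum {K : Type} [Field K] [CompatibleRing K] {ι : Type} [Fintype ι]
    (f : ι → Language.ring.Term α) (v : α → K) :
    (termSum f).realize v = ∑ i, (f i).realize v := by
  rw [termSum, ← Finset.sum_map_toList]
  induction (Finset.univ : Finset ι).toList with
  | nil => simp
  | cons a l ih => simp [ih]

/-- The product of a finite family of ring terms (iterated over `Finset.univ.toList`). -/
noncomputable def termProd {ι : Type} [Fintype ι] (f : ι → Language.ring.Term α) :
    Language.ring.Term α :=
  ((Finset.univ : Finset ι).toList.map f).foldr (· * ·) 1

/-- `termProd f` realises `∏ i, f i`. -/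
theorem realize_termProd {K : Type} [Field K] [CompatibleRing K] {ι : Type} [Fintype ι]
    (f : ι → Language.ring.Term α) (v : α → K) :
    (termProd f).realize v = ∏ i, (f i).realize v := by
  rw [termProd, ← Finset.prod_map_toList]
  induction (Finset.univ : Finset ι).toList with
  | nil => simp
  | cons a l ih => simp [ih]

/-- The box polynomial `Σ_β d_β ∏_l (a_l − u_l)^{β l}` (`β : Fin m → Fin (N + 1)`) as a ring term in
the variables `d_β := fd β`, `a_l := fa l`, `u_l := fu l`. -/
noncomputable def boxTerm (m N : ℕ) (fd : (Fin m → Fin (N + 1)) → α) (fa fu : Fin m → α) :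
    Language.ring.Term α :=
  termSum fun β : Fin m → Fin (N + 1) =>
    Term.var (fd β) * termProd fun l : Fin m => termPow (Term.var (fa l) + -Term.var (fu l)) (β l)

/-- `boxTerm` realises the box sum. -/
theorem realize_boxTerm {K : Type} [Field K] [CompatibleRing K] (m N : ℕ)
    (fd : (Fin m → Fin (N + 1)) → α) (fa fu : Fin m → α) (v : α → K) :
    (boxTerm m N fd fa fu).realize v =
      ∑ β : Fin m → Fin (N + 1), v (fd β) * ∏ l : Fin m, (v (fa l) - v (fu l)) ^ ((β l : ℕ)) := by
  simp only [boxTerm, realize_termSum, realize_mul, Term.realize_var, realize_termProd,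
    realize_termPow, realize_add, realize_neg, sub_eq_add_neg]

end Terms

section Definability

variable {α β γ : Type}

/-- Definable predicates are closed under implication. -/
theorem definable_imp {P Q : ∀ (K : Type) [Field K] [CompatibleRing K], (α → K) → Prop}
    (hP : ∃ θ : Language.ring.Formula α, ∀ (K : Type) [Field K] [CompatibleRing K] (v : α → K),
      θ.Realize v ↔ P K v)
    (hQ : ∃ θ : Language.ring.Formula α, ∀ (K : Type) [Field K] [CompatibleRing K] (v : α → K),
      θ.Realize v ↔ Q K v) :
    ∃ θ : Language.ring.Formula α, ∀ (K : Type) [Field K] [CompatibleRing K] (v : α → K),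
      θ.Realize v ↔ (P K v → Q K v) := by
  obtain ⟨θ, hθ⟩ := hP
  obtain ⟨ψ, hψ⟩ := hQ
  exact ⟨θ.imp ψ, fun K _ _ v => (Formula.realize_imp).trans (imp_congr (hθ K v) (hψ K v))⟩

/-- Definable predicates are closed under conjunction. -/
theorem definable_and {P Q : ∀ (K : Type) [Field K] [CompatibleRing K], (α → K) → Prop}
    (hP : ∃ θ : Language.ring.Formula α, ∀ (K : Type) [Field K] [CompatibleRing K] (v : α → K),
      θ.Realize v ↔ P K v)
    (hQ : ∃ θ : Language.ring.Formula α, ∀ (K : Type) [Field K] [CompatibleRing K] (v : α → K),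
      θ.Realize v ↔ Q K v) :
    ∃ θ : Language.ring.Formula α, ∀ (K : Type) [Field K] [CompatibleRing K] (v : α → K),
      θ.Realize v ↔ (P K v ∧ Q K v) := by
  obtain ⟨θ, hθ⟩ := hP
  obtain ⟨ψ, hψ⟩ := hQ
  exact ⟨θ ⊓ ψ, fun K _ _ v => (Formula.realize_inf).trans (and_congr (hθ K v) (hψ K v))⟩

/-- Definable predicates are closed under finite conjunctions. -/
theorem definable_iInf {ι : Type} [Finite ι]
    {P : ι → ∀ (K : Type) [Field K] [CompatibleRing K], (α → K) → Prop}
    (h : ∀ i, ∃ θ : Language.ring.Formula α, ∀ (K : Type) [Field K] [CompatibleRing K]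
      (v : α → K), θ.Realize v ↔ P i K v) :
    ∃ θ : Language.ring.Formula α, ∀ (K : Type) [Field K] [CompatibleRing K] (v : α → K),
      θ.Realize v ↔ ∀ i, P i K v := by
  choose θ hθ using h
  exact ⟨Formula.iInf θ, fun K _ _ v =>
    (Formula.realize_iInf).trans (forall_congr' fun i => hθ i K v)⟩

/-- Definable predicates are closed under universal quantification over a finite block of new
variables (`Formula.iAlls`). -/
theorem definable_forall [Finite β]
    {P : ∀ (K : Type) [Field K] [CompatibleRing K], (α → K) → (β → K) → Prop}
    (h : ∃ θ : Language.ring.Formula (α ⊕ β), ∀ (K : Type) [Field K] [CompatibleRing K]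
      (v : α ⊕ β → K), θ.Realize v ↔ P K (fun a => v (Sum.inl a)) (fun b => v (Sum.inr b))) :
    ∃ θ : Language.ring.Formula α, ∀ (K : Type) [Field K] [CompatibleRing K] (v : α → K),
      θ.Realize v ↔ ∀ w : β → K, P K v w := by
  obtain ⟨θ, hθ⟩ := h
  refine ⟨θ.iAlls β, fun K _ _ v => ?_⟩
  rw [Formula.realize_iAlls]
  refine forall_congr' fun w => ?_
  rw [hθ]
  simp only [Sum.elim_inl, Sum.elim_inr]

/-- Definable predicates are closed under existential quantification over a finite block of new
variables (`Formula.iExs`). -/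
theorem definable_exists [Finite β]
    {P : ∀ (K : Type) [Field K] [CompatibleRing K], (α → K) → (β → K) → Prop}
    (h : ∃ θ : Language.ring.Formula (α ⊕ β), ∀ (K : Type) [Field K] [CompatibleRing K]
      (v : α ⊕ β → K), θ.Realize v ↔ P K (fun a => v (Sum.inl a)) (fun b => v (Sum.inr b))) :
    ∃ θ : Language.ring.Formula α, ∀ (K : Type) [Field K] [CompatibleRing K] (v : α → K),
      θ.Realize v ↔ ∃ w : β → K, P K v w := by
  obtain ⟨θ, hθ⟩ := h
  refine ⟨θ.iExs β, fun K _ _ v => ?_⟩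
  rw [Formula.realize_iExs]
  refine exists_congr fun w => ?_
  rw [hθ]
  simp only [Sum.elim_inl, Sum.elim_inr]

/-- Definable predicates are closed under existential quantification over a finite tuple of tuples
of new variables. -/
theorem definable_exists₂ [Finite β] [Finite γ]
    {P : ∀ (K : Type) [Field K] [CompatibleRing K], (α → K) → (β → γ → K) → Prop}
    (h : ∃ θ : Language.ring.Formula (α ⊕ β × γ), ∀ (K : Type) [Field K] [CompatibleRing K]
      (v : α ⊕ β × γ → K),
      θ.Realize v ↔ P K (fun a => v (Sum.inl a)) (fun b c => v (Sum.inr (b, c)))) :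
    ∃ θ : Language.ring.Formula α, ∀ (K : Type) [Field K] [CompatibleRing K] (v : α → K),
      θ.Realize v ↔ ∃ w : β → γ → K, P K v w := by
  obtain ⟨θ, hθ⟩ := h
  refine ⟨θ.iExs (β × γ), fun K _ _ v => ?_⟩
  rw [Formula.realize_iExs]
  constructor
  · rintro ⟨g, hg⟩
    rw [hθ] at hg
    simp only [Sum.elim_inl, Sum.elim_inr] at hg
    exact ⟨_, hg⟩
  · rintro ⟨w, hw⟩
    refine ⟨fun p => w p.1 p.2, ?_⟩
    rw [hθ]
    simpa only [Sum.elim_inl, Sum.elim_inr] using hw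

/-- An instance `φ(v ∘ f₁, v ∘ f₂)` of a ring formula at re-indexed variables is definable. -/
theorem definable_realize₂ {β₁ β₂ : Type} (φ : Language.ring.Formula (β₁ ⊕ β₂)) (f₁ : β₁ → α)
    (f₂ : β₂ → α) :
    ∃ θ : Language.ring.Formula α, ∀ (K : Type) [Field K] [CompatibleRing K] (v : α → K),
      θ.Realize v ↔ φ.Realize (Sum.elim (fun b => v (f₁ b)) (fun b => v (f₂ b))) := by
  refine ⟨φ.relabel (Sum.elim f₁ f₂), fun K _ _ v => ?_⟩
  rw [Formula.realize_relabel]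
  exact iff_of_eq (congrArg _ (funext fun x => by cases x <;> rfl))

/-- An instance `φ((v ∘ f₁, v ∘ f₂), v ∘ f₃)` of a ring formula at re-indexed variables is
definable. -/
theorem definable_realize₃ {β₁ β₂ β₃ : Type} (φ : Language.ring.Formula ((β₁ ⊕ β₂) ⊕ β₃))
    (f₁ : β₁ → α) (f₂ : β₂ → α) (f₃ : β₃ → α) :
    ∃ θ : Language.ring.Formula α, ∀ (K : Type) [Field K] [CompatibleRing K] (v : α → K),
      θ.Realize v ↔
        φ.Realize
          (Sum.elim (Sum.elim (fun b => v (f₁ b)) (fun b => v (f₂ b))) (fun b => v (f₃ b))) := by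
  refine ⟨φ.relabel (Sum.elim (Sum.elim f₁ f₂) f₃), fun K _ _ v => ?_⟩
  rw [Formula.realize_relabel]
  exact iff_of_eq (congrArg _ (funext fun x => by rcases x with (x | x) | x <;> rfl))

/-- Equality of two tuples of variables is definable. -/
theorem definable_vecEq {ι : Type} [Finite ι] (f₁ f₂ : ι → α) :
    ∃ θ : Language.ring.Formula α, ∀ (K : Type) [Field K] [CompatibleRing K] (v : α → K),
      θ.Realize v ↔ (fun i => v (f₁ i)) = fun i => v (f₂ i) := by
  refine ⟨Formula.iInf fun i => Term.equal (Term.var (f₁ i)) (Term.var (f₂ i)),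
    fun K _ _ v => ?_⟩
  simp only [Formula.realize_iInf, Formula.realize_equal, Term.realize_var, funext_iff]

/-- Non-vanishing of a tuple of variables is definable. -/
theorem definable_vecNeZero {ι : Type} [Finite ι] (f : ι → α) :
    ∃ θ : Language.ring.Formula α, ∀ (K : Type) [Field K] [CompatibleRing K] (v : α → K),
      θ.Realize v ↔ (fun i => v (f i)) ≠ 0 := by
  refine ⟨(Formula.iInf fun i => Term.equal (Term.var (f i)) 0).not, fun K _ _ v => ?_⟩
  simp only [Formula.realize_not, Formula.realize_iInf, Formula.realize_equal, Term.realize_var,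
    realize_zero, Ne, funext_iff, Pi.zero_apply]

/-- The STPP equation "a sum of three differences of tuples of variables vanishes" is
definable. -/
theorem definable_patEq {ι : Type} [Finite ι] (f₁ f₂ f₃ f₄ f₅ f₆ : ι → α) :
    ∃ θ : Language.ring.Formula α, ∀ (K : Type) [Field K] [CompatibleRing K] (v : α → K),
      θ.Realize v ↔
        ((fun i => v (f₁ i)) - fun i => v (f₂ i)) + ((fun i => v (f₃ i)) - fun i => v (f₄ i)) +
          ((fun i => v (f₅ i)) - fun i => v (f₆ i)) = 0 := by
  refine ⟨Formula.iInf fun i => Term.equal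
    ((Term.var (f₁ i) + -Term.var (f₂ i)) + (Term.var (f₃ i) + -Term.var (f₄ i)) +
      (Term.var (f₅ i) + -Term.var (f₆ i))) 0, fun K _ _ v => ?_⟩
  simp only [funext_iff, Pi.add_apply, Pi.sub_apply, Pi.zero_apply]
  simp only [Formula.realize_iInf, Formula.realize_equal, Term.realize_var, realize_add,
    realize_neg, realize_zero, sub_eq_add_neg]

/-- Injectivity of a finite tuple of tuples of variables ("the tuples `(v (f j ·))_j` are pairwise
distinct") is definable. -/
theorem definable_injective {ι κ : Type} [Finite ι] [Finite κ] (f : ι → κ → α) :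
    ∃ θ : Language.ring.Formula α, ∀ (K : Type) [Field K] [CompatibleRing K] (v : α → K),
      θ.Realize v ↔ Function.Injective fun j l => v (f j l) := by
  classical
  refine ⟨Formula.iInf fun j => Formula.iInf fun j' =>
    if j = j' then ⊤
    else (Formula.iInf fun l => Term.equal (Term.var (f j l)) (Term.var (f j' l))).not,
    fun K _ _ v => ?_⟩
  simp only [Formula.realize_iInf]
  constructor
  · intro h j j' hjj'
    by_contra hne
    have := h j j'
    rw [if_neg hne, Formula.realize_not, Formula.realize_iInf] at this
    exact this fun l => by simpa using congrFun hjj' l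
  · intro h j j'
    split_ifs with hjj'
    · exact Formula.realize_top.2 trivial
    · rw [Formula.realize_not, Formula.realize_iInf]
      intro hall
      exact hjj' (h (funext fun l => by simpa using hall l))

/-- The box-polynomial equation `Σ_β d_β ∏_l (a_l − u_l)^{β l} = 0` in variables `d_β, a_l, u_l` is
definable (by the atomic formula `boxTerm = 0`). -/
theorem definable_boxEq (m N : ℕ) (fd : (Fin m → Fin (N + 1)) → α) (fa fu : Fin m → α) :
    ∃ θ : Language.ring.Formula α, ∀ (K : Type) [Field K] [CompatibleRing K] (v : α → K),
      θ.Realize v ↔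
        ∑ β : Fin m → Fin (N + 1), v (fd β) *
          ∏ l : Fin m, ((fun i => v (fa i)) - fun i => v (fu i)) l ^ ((β l : ℕ)) = 0 := by
  refine ⟨Term.equal (boxTerm m N fd fa fu) 0, fun K _ _ v => ?_⟩
  rw [Formula.realize_equal, realize_boxTerm, realize_zero]
  simp only [Pi.sub_apply]

end Definability

/-- Semantics of the encoding formula `θ_{C,N}(y)`: IF the realised family at parameters `y`
satisfies pattern `i = j` THEN some non-zero box polynomial of exponents `≤ N` vanishes at every
`a − c`, `a ∈ A_x`, `c ∈ C_x`, over the blocks `x ∈ I` whose `B_x` has `C + 1` distinct points. -/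
def LonelyShadowSem (e m k : ℕ) (φI : Language.ring.Formula (Fin e ⊕ Fin k))
    (φA φB φC : Language.ring.Formula ((Fin e ⊕ Fin m) ⊕ Fin k)) (C N : ℕ)
    (K : Type) [Field K] [CompatibleRing K] (y : Fin k → K) : Prop :=
  (∀ i, φI.Realize (Sum.elim i y) → ∀ i', φI.Realize (Sum.elim i' y) →
      ∀ s, φA.Realize (Sum.elim (Sum.elim i' s) y) → ∀ s', φA.Realize (Sum.elim (Sum.elim i s') y) →
      ∀ t, φB.Realize (Sum.elim (Sum.elim i t) y) → ∀ t', φB.Realize (Sum.elim (Sum.elim i t') y) →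
      ∀ u, φC.Realize (Sum.elim (Sum.elim i u) y) → ∀ u', φC.Realize (Sum.elim (Sum.elim i' u') y) →
        (s' - s) + (t' - t) + (u' - u) = 0 → i = i' ∧ s = s' ∧ t = t' ∧ u = u') →
    ∃ d : (Fin m → Fin (N + 1)) → K, d ≠ 0 ∧
      ∀ x, φI.Realize (Sum.elim x y) →
        (∃ w : Fin (C + 1) → (Fin m → K), Function.Injective w ∧
            ∀ j, φB.Realize (Sum.elim (Sum.elim x (w j)) y)) →
          ∀ a, φA.Realize (Sum.elim (Sum.elim x a) y) → ∀ u, φC.Realize (Sum.elim (Sum.elim x u) y) →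
            ∑ β : Fin m → Fin (N + 1), d β * ∏ l : Fin m, (a - u) l ^ ((β l : ℕ)) = 0

/-- **Stub F (first-order encoding).** `LonelyShadowSem … C N K y` is the realisation of ONE ring
formula `θ_{C,N}` in the parameter variables `y`, uniformly in the field `K` with a compatible ring
structure.  The proof follows the syntax tree of `LonelyShadowSem` with the closure properties
`definable_*` above. -/
theorem stub_exists_lonelyShadowFormula (e m k : ℕ) (φI : Language.ring.Formula (Fin e ⊕ Fin k))
    (φA φB φC : Language.ring.Formula ((Fin e ⊕ Fin m) ⊕ Fin k)) (C N : ℕ) :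
    ∃ θ : Language.ring.Formula (Fin k), ∀ (K : Type) [Field K] [CompatibleRing K]
      (y : Fin k → K), θ.Realize y ↔ LonelyShadowSem e m k φI φA φB φC C N K y := by
  unfold LonelyShadowSem
  refine definable_imp ?_ ?_
  · -- the pattern hypothesis: `∀ i i' s s' t t' u u'` with the eight membership conditions
    refine definable_forall ?_
    refine definable_imp (definable_realize₂ φI _ _) ?_
    refine definable_forall ?_
    refine definable_imp (definable_realize₂ φI _ _) ?_
    refine definable_forall ?_
    refine definable_imp (definable_realize₃ φA _ _ _) ?_
    refine definable_forall ?_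
    refine definable_imp (definable_realize₃ φA _ _ _) ?_
    refine definable_forall ?_
    refine definable_imp (definable_realize₃ φB _ _ _) ?_
    refine definable_forall ?_
    refine definable_imp (definable_realize₃ φB _ _ _) ?_
    refine definable_forall ?_
    refine definable_imp (definable_realize₃ φC _ _ _) ?_
    refine definable_forall ?_
    refine definable_imp (definable_realize₃ φC _ _ _) ?_
    refine definable_imp (definable_patEq _ _ _ _ _ _) ?_
    exact definable_and (definable_vecEq _ _) (definable_and (definable_vecEq _ _)
      (definable_and (definable_vecEq _ _) (definable_vecEq _ _)))
  · -- the box conclusion: `∃ d ≠ 0, ∀ x ∈ I, (C+1 distinct points in B_x) → ∀ a u, box(a−u) = 0`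
    refine definable_exists ?_
    refine definable_and (definable_vecNeZero _) ?_
    refine definable_forall ?_
    refine definable_imp (definable_realize₂ φI _ _) ?_
    refine definable_imp ?_ ?_
    · refine definable_exists₂ ?_
      refine definable_and (definable_injective _) ?_
      exact definable_iInf fun j => definable_realize₃ φB _ _ _
    refine definable_forall ?_
    refine definable_imp (definable_realize₃ φA _ _ _) ?_
    refine definable_forall ?_
    refine definable_imp (definable_realize₃ φC _ _ _) ?_
    exact definable_boxEq m N _ _ _

end Summit.MatrixMultiplication.MatrixMultiplication.Theorems.PairwiseCurvedTilingsLC.Negative
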